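import Literature.RingTheory.SymmetricFunctions.ShintaniSelfSum
import Literature.NumberTheory.Automorphic.AutomorphicLFunctionProofs
import HarnessLib

/-!
# From dyadic mean-square bounds to bounded Schur self-sum products on `GL₂`

Topic `NumberTheory/Automorphic`; namespace `Literature.NumberTheory.Automorphic`. The analytic
adapter of the mean-square route to Jacquet–Shalika's Theorem (5.3) for `GL₂`
(`StandardLFunctionData.multipliable_L`): the mean-square bricks (`MeanSquareUpperGL2`,
`MeanSquareLowerGL2`) bound, uniformly in `X ≥ 1`, the dyadic sums
`∑_{X/2 ≤ q_v^k ≤ X} q_v^{-k} |s_k(x_v)|²` of the Satake–Schur values `s_k(x_v) = s_{(k,0)}(x_v)` at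
the good places; the input of `JacquetShalika1981_schurSelfSum_prod_bounded`
(`JacquetShalikaSchurSelfSum`) is a uniform bound for the finite products
`∏_{v ∈ F} schurSelfSum (x_v) (q_v^{-σ})`, `σ > 1`. This file passes from one to the other:

* `schur_shift_fin_two` — **`s_{(b+k, b)} = (x₀x₁)^b s_{(k,0)}`** in two variables over any
  commutative ring (bialternant formula in `ℤ[X₀, X₁]`, cancellation of `a_ρ = X₀ - X₁`, and
  specialisation); `norm_schur_shift_fin_two` (`|s_{(b+k,b)}| = |s_{(k,0)}|` when `|x₀x₁| = 1`);
* `schurSelfSum_eq_tsum`, `schurSelfSum_fin_two_eq` — **`schurSelfSum x t = (∑_b t^{2b}) ·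
  ∑_k |s_{(k,0)}(x)|² t^k`** for `|x₀ x₁| = 1`;
* `dyadicWeight`, `sigmaWeight`, `DyadicBound x Good B` (the dyadic hypothesis),
  `tsum_sigmaWeight_le` — **dyadic summation**: `∑_{v ∈ Good, k ≥ 1} (q_v^k)^{-σ} |s_k(x_v)|² ≤
  B (1 - 2^{1-σ})⁻¹`;
* `schurSelfSum_prod_le_of_dyadicBound` — **the bounded products**: with `|x_{v,0} x_{v,1}| = 1` on
  `Good` (unitarity of the central character) and `DyadicBound x Good B`, `B < ∞`, the products over
  finite `F ⊆ Good` are `≤ exp(2 ∑_v q_v^{-2σ}) · exp(B (1 - 2^{1-σ})⁻¹)`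
  (`summable_residueCard_rpow_neg` for the `ζ_K(2σ)`-type factor).

Everything is proved; folklore (Rankin's trick with dyadic blocks; the `L(2s, ω)` factor of
Jacquet–Shalika (1981), (5.3.4)).
-/

noncomputable section

open Finset
open scoped ENNReal NNReal

namespace Literature.NumberTheory.Automorphic

open Literature.RingTheory.SymmetricFunctions.SymmPoly NumberField IsDedekindDomain

/-! ### The shift identity for Schur polynomials in two variables -/

section Shift

variable {R : Type*} [CommRing R]

/-- `ρ = (1, 0)` for `n = 2`. [folklore] -/
theorem rho_two : rho 2 = ![1, 0] := by
  funext i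
  fin_cases i <;> rfl

/-- The alternant of `GL₂`: `a_μ(x) = x₀^{μ₀} x₁^{μ₁} - x₀^{μ₁} x₁^{μ₀}`. [folklore] -/
theorem alternant_fin_two (x : Fin 2 → R) (μ : Fin 2 → ℕ) :
    alternant x μ = x 0 ^ μ 0 * x 1 ^ μ 1 - x 0 ^ μ 1 * x 1 ^ μ 0 := by
  rw [alternant, Matrix.det_fin_two]
  simp only [Matrix.of_apply]

/-- `a_{(b+k, b) + ρ} = (x₀ x₁)^b a_{(k, 0) + ρ}`. [folklore] -/
theorem alternant_shift_fin_two (x : Fin 2 → R) (b k : ℕ) :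
    alternant x (![b + k, b] + rho 2) = (x 0 * x 1) ^ b * alternant x (![k, 0] + rho 2) := by
  rw [rho_two, alternant_fin_two, alternant_fin_two]
  simp only [Pi.add_apply, Matrix.cons_val_zero, Matrix.cons_val_one]
  ring

/-- **The shift identity `s_{(b+k, b)} = (x₀ x₁)^b s_{(k, 0)}`** for Schur polynomials in two
variables over any commutative ring: by the bialternant formula in the polynomial ring
`ℤ[X₀, X₁]` (a domain, where `a_ρ = X₀ - X₁ ≠ 0` can be cancelled) and specialisation.
[folklore] -/
theorem schur_shift_fin_two (x : Fin 2 → R) (b k : ℕ) :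
    schur x ![b + k, b] = (x 0 * x 1) ^ b * schur x ![k, 0] := by
  -- the universal case
  have huniv : schur (MvPolynomial.X : Fin 2 → MvPolynomial (Fin 2) ℤ) ![b + k, b] =
      (MvPolynomial.X 0 * MvPolynomial.X 1) ^ b * schur (MvPolynomial.X : Fin 2 → MvPolynomial (Fin 2) ℤ) ![k, 0] := by
    have hne : alternant (MvPolynomial.X : Fin 2 → MvPolynomial (Fin 2) ℤ) (rho 2) ≠ 0 :=
      alternant_rho_ne_zero (MvPolynomial.X_injective)
    apply mul_right_cancel₀ hne
    rw [← alternant_add_rho, alternant_shift_fin_two, alternant_add_rho, mul_assoc]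
  -- specialise along `aeval x`
  have h := congrArg (MvPolynomial.aeval x : MvPolynomial (Fin 2) ℤ →ₐ[ℤ] R) huniv
  rw [map_mul, map_pow, map_mul] at h
  have h1 : ∀ la, (MvPolynomial.aeval x : MvPolynomial (Fin 2) ℤ →ₐ[ℤ] R)
      (schur (MvPolynomial.X : Fin 2 → MvPolynomial (Fin 2) ℤ) la) = schur x la := by
    intro la
    rw [← AlgHom.coe_toRingHom, map_schur]
    congr 1
    funext i
    simp
  rw [h1, h1, MvPolynomial.aeval_X, MvPolynomial.aeval_X] at h
  exact h

/-- `|s_{(b+k, b)}(x)| = |s_{(k,0)}(x)|` when `|x₀ x₁| = 1`. [folklore] -/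
theorem norm_schur_shift_fin_two {x : Fin 2 → ℂ} (hx : ‖x 0 * x 1‖ = 1) (b k : ℕ) :
    ‖schur x ![b + k, b]‖ = ‖schur x ![k, 0]‖ := by
  rw [schur_shift_fin_two, norm_mul, norm_pow, hx, one_pow, one_mul]

/-- Antitone weights of length `2` are the `(b + k, b)`. [folklore] -/
theorem antitone_fin_two_iff (m : Fin 2 → ℕ) : Antitone m ↔ m 1 ≤ m 0 := by
  constructor
  · intro h; exact h (by decide)
  · intro h i j hij
    fin_cases i <;> fin_cases j
    · exact le_rfl
    · exact h
    · exact absurd hij (by decide)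
    · exact le_rfl

/-- `(b + k, b)` as a weight. [folklore] -/
def shiftWeight (p : ℕ × ℕ) : Fin 2 → ℕ := ![p.1 + p.2, p.1]

/-- `shiftWeight` is injective. [folklore] -/
theorem shiftWeight_injective : Function.Injective shiftWeight := by
  intro p q h
  have h0 := congrFun h 0
  have h1 := congrFun h 1
  simp only [shiftWeight, Matrix.cons_val_zero, Matrix.cons_val_one] at h0 h1
  ext
  · exact h1
  · omega

/-- The antitone weights are exactly the range of `shiftWeight`. [folklore] -/
theorem mem_range_shiftWeight_of_antitone {m : Fin 2 → ℕ} (hm : Antitone m) : m ∈ Set.range shiftWeight := by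
  refine ⟨(m 1, m 0 - m 1), ?_⟩
  have h := (antitone_fin_two_iff m).1 hm
  funext i
  fin_cases i
  · simp [shiftWeight]; omega
  · simp [shiftWeight]

end Shift

/-! ### The Schur self sum in two variables -/

section SelfSum

/-- The self sum as a series over all weights. [folklore] -/
theorem schurSelfSum_eq_tsum {n : ℕ} (x : Fin n → ℂ) (t : ℝ) :
    schurSelfSum x t = ∑' m : Fin n → ℕ, ENNReal.ofReal (‖schurTrunc x m‖ ^ 2 * t ^ (∑ i, m i)) := by
  classical
  set g : (Fin n → ℕ) → ℝ≥0∞ := fun m => ENNReal.ofReal (‖schurTrunc x m‖ ^ 2 * t ^ (∑ i, m i)) with hg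
  rw [schurSelfSum, shintaniSelfSum]
  by_cases ht : 0 ≤ t
  · have h1 : ∀ N, ENNReal.ofReal ((∑ m ∈ piAntidiag univ N, ‖schurTrunc x m‖ ^ 2) * t ^ N) =
        ∑ m ∈ piAntidiag univ N, g m := by
      intro N
      rw [Finset.sum_mul, ENNReal.ofReal_sum_of_nonneg (fun m _ => by positivity)]
      refine Finset.sum_congr rfl fun m hm => ?_
      rw [hg]
      simp only
      rw [(mem_piAntidiag.1 hm).1]
    simp_rw [h1]
    -- `Σ'_N Σ_{m ∈ A_N} g m = Σ' m, g m`
    have h2 : ∀ N, ∑ m ∈ piAntidiag univ N, g m =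
        ∑' m, ((piAntidiag univ N : Finset (Fin n → ℕ)) : Set (Fin n → ℕ)).indicator g m :=
      fun N => sum_eq_tsum_indicator g (piAntidiag univ N)
    simp_rw [h2]
    rw [ENNReal.tsum_comm]
    refine tsum_congr fun m => ?_
    rw [tsum_eq_single (∑ i, m i)]
    · rw [Set.indicator_of_mem]
      simp [mem_piAntidiag]
    · intro N hN
      rw [Set.indicator_of_notMem]
      simp only [Finset.mem_coe, mem_piAntidiag, Finset.mem_univ, imp_true_iff, and_true]
      exact fun h => hN h.symm
  · -- for `t < 0` both sides are the `N = 0` / `m = 0` term `ofReal (‖w 0‖²)`: odd powers are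
    -- negative and `ofReal` kills them; we avoid this case distinction by reducing to it directly
    push Not at ht
    -- both sides equal `∑` of the same nonnegative-real family after clipping; prove equality of
    -- each clipped term family via the same reindexing as above, applied to `t` replaced by `0`
    -- is not literally true, so we argue directly: split each `N`-term.
    have h1 : ∀ N, ENNReal.ofReal ((∑ m ∈ piAntidiag univ N, ‖schurTrunc x m‖ ^ 2) * t ^ N) =
        ∑ m ∈ piAntidiag univ N, g m := by
      intro N
      rcases Nat.even_or_odd N with hN | hN
      · have htN : 0 ≤ t ^ N := hN.pow_nonneg t
        rw [Finset.sum_mul, ENNReal.ofReal_sum_of_nonneg (fun m _ => by positivity)]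
        refine Finset.sum_congr rfl fun m hm => ?_
        rw [hg]
        simp only
        rw [(mem_piAntidiag.1 hm).1]
      · have htN : t ^ N ≤ 0 := (hN.pow_neg ht).le
        rw [ENNReal.ofReal_of_nonpos (mul_nonpos_of_nonneg_of_nonpos (Finset.sum_nonneg fun _ _ => by positivity) htN)]
        symm
        refine Finset.sum_eq_zero fun m hm => ?_
        rw [hg]
        simp only
        rw [(mem_piAntidiag.1 hm).1]
        exact ENNReal.ofReal_of_nonpos (mul_nonpos_of_nonneg_of_nonpos (by positivity) htN)
    simp_rw [h1]
    have h2 : ∀ N, ∑ m ∈ piAntidiag univ N, g m =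
        ∑' m, ((piAntidiag univ N : Finset (Fin n → ℕ)) : Set (Fin n → ℕ)).indicator g m :=
      fun N => sum_eq_tsum_indicator g (piAntidiag univ N)
    simp_rw [h2]
    rw [ENNReal.tsum_comm]
    refine tsum_congr fun m => ?_
    rw [tsum_eq_single (∑ i, m i)]
    · rw [Set.indicator_of_mem]
      simp [mem_piAntidiag]
    · intro N hN
      rw [Set.indicator_of_notMem]
      simp only [Finset.mem_coe, mem_piAntidiag, Finset.mem_univ, imp_true_iff, and_true]
      exact fun h => hN h.symm

/-- **The Schur self sum of `GL₂` factors**: for `|x₀ x₁| = 1`,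
`schurSelfSum x t = (∑_b t^{2b}) · ∑_k |s_{(k,0)}(x)|² t^k` (shift identity `|s_{(b+k,b)}| =
|s_{(k,0)}|`). [folklore] -/
theorem schurSelfSum_fin_two_eq {x : Fin 2 → ℂ} (hx : ‖x 0 * x 1‖ = 1) (t : ℝ) :
    schurSelfSum x t = (∑' b : ℕ, ENNReal.ofReal (t ^ 2) ^ b) *
      ∑' k : ℕ, ENNReal.ofReal (‖schur x ![k, 0]‖ ^ 2 * t ^ k) := by
  rw [schurSelfSum_eq_tsum]
  set g : (Fin 2 → ℕ) → ℝ≥0∞ := fun m => ENNReal.ofReal (‖schurTrunc x m‖ ^ 2 * t ^ (∑ i, m i)) with hg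
  have hsupp : Function.support g ⊆ Set.range shiftWeight := by
    intro m hm
    refine mem_range_shiftWeight_of_antitone ?_
    by_contra hanti
    apply hm
    change ENNReal.ofReal (‖schurTrunc x m‖ ^ 2 * t ^ (∑ i, m i)) = 0
    rw [schurTrunc_of_not_antitone x hanti, norm_zero, zero_pow two_ne_zero, zero_mul, ENNReal.ofReal_zero]
  rw [← shiftWeight_injective.tsum_eq hsupp]
  have hterm : ∀ p : ℕ × ℕ, g (shiftWeight p) =
      ENNReal.ofReal (t ^ 2) ^ p.1 * ENNReal.ofReal (‖schur x ![p.2, 0]‖ ^ 2 * t ^ p.2) := by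
    rintro ⟨b, k⟩
    have hanti : Antitone (shiftWeight (b, k)) := (antitone_fin_two_iff _).2 (by simp [shiftWeight])
    change ENNReal.ofReal (‖schurTrunc x (shiftWeight (b, k))‖ ^ 2 * t ^ (∑ i, shiftWeight (b, k) i)) = _
    rw [schurTrunc, if_pos hanti]
    have hsum : (∑ i, shiftWeight (b, k) i) = (b + k) + b := by
      simp [shiftWeight, Fin.sum_univ_two]
    rw [hsum]
    change ENNReal.ofReal (‖schur x ![b + k, b]‖ ^ 2 * t ^ ((b + k) + b)) = _
    rw [norm_schur_shift_fin_two hx, ← ENNReal.ofReal_pow (sq_nonneg t), ← ENNReal.ofReal_mul (by positivity)]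
    congr 1
    ring
  simp_rw [hterm]
  rw [ENNReal.tsum_prod', ← ENNReal.tsum_mul_right]
  refine tsum_congr fun b => ?_
  dsimp only
  rw [ENNReal.tsum_mul_left]

/-- `s_{(0,0)} = 1`. [folklore] -/
theorem schur_vecCons_zero_zero (x : Fin 2 → ℂ) : schur x ![0, 0] = 1 := by
  have h : (![0, 0] : Fin 2 → ℕ) = 0 := by funext i; fin_cases i <;> rfl
  rw [h, schur_zero]

end SelfSum

/-! ### Dyadic summation -/

section Dyadic

variable {K : Type} [Field K] [NumberField K]

open scoped Classical in
/-- The **dyadic weight** `q_v^{-k} |s_k(x_v)|²` of a pair `(v, k)`, `v ∈ Good`, `k ≥ 1` (else `0`).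
[folklore] -/
def dyadicWeight (x : HeightOneSpectrum (𝓞 K) → Fin 2 → ℂ) (Good : Set (HeightOneSpectrum (𝓞 K)))
    (p : HeightOneSpectrum (𝓞 K) × ℕ) : ℝ≥0∞ :=
  if p.1 ∈ Good ∧ 1 ≤ p.2 then ENNReal.ofReal (((p.1.residueCard : ℝ) ^ p.2)⁻¹ * ‖schur (x p.1) ![p.2, 0]‖ ^ 2) else 0

open scoped Classical in
/-- The **`σ`-weight** `(q_v^k)^{-σ} |s_k(x_v)|²` of a pair `(v, k)`, `v ∈ Good`, `k ≥ 1` (else `0`).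
[folklore] -/
def sigmaWeight (x : HeightOneSpectrum (𝓞 K) → Fin 2 → ℂ) (Good : Set (HeightOneSpectrum (𝓞 K))) (σ : ℝ)
    (p : HeightOneSpectrum (𝓞 K) × ℕ) : ℝ≥0∞ :=
  if p.1 ∈ Good ∧ 1 ≤ p.2 then ENNReal.ofReal ((((p.1.residueCard : ℝ) ^ p.2) ^ (-σ)) * ‖schur (x p.1) ![p.2, 0]‖ ^ 2) else 0

/-- The **dyadic hypothesis**: the single-place dyadic sums `∑_{(v,k) : X/2 ≤ q_v^k ≤ X} q_v^{-k} |s_k(x_v)|²`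
(`v ∈ Good`, `k ≥ 1`) are `≤ B` for every `X ≥ 1`. [folklore] -/
def DyadicBound (x : HeightOneSpectrum (𝓞 K) → Fin 2 → ℂ) (Good : Set (HeightOneSpectrum (𝓞 K))) (B : ℝ≥0∞) : Prop :=
  ∀ X : ℝ, 1 ≤ X → ∀ T : Finset (HeightOneSpectrum (𝓞 K) × ℕ),
    (∀ p ∈ T, p.1 ∈ Good ∧ 1 ≤ p.2 ∧ X / 2 ≤ (p.1.residueCard : ℝ) ^ p.2 ∧ (p.1.residueCard : ℝ) ^ p.2 ≤ X) →
    ∑ p ∈ T, ENNReal.ofReal (((p.1.residueCard : ℝ) ^ p.2)⁻¹ * ‖schur (x p.1) ![p.2, 0]‖ ^ 2) ≤ B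

/-- Pointwise comparison of the `σ`-weight with the dyadic weight on its dyadic block
`2^j ≤ q_v^k < 2^{j+1}`: `(q^k)^{-σ} ≤ (q^k)⁻¹ (2^{1-σ})^j`. [folklore] -/
theorem sigmaWeight_le (x : HeightOneSpectrum (𝓞 K) → Fin 2 → ℂ) (Good : Set (HeightOneSpectrum (𝓞 K)))
    {σ : ℝ} (hσ : 1 < σ) (p : HeightOneSpectrum (𝓞 K) × ℕ) :
    sigmaWeight x Good σ p ≤
      ENNReal.ofReal ((2 : ℝ) ^ (1 - σ)) ^ Nat.log 2 (p.1.residueCard ^ p.2) * dyadicWeight x Good p := by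
  classical
  rw [sigmaWeight, dyadicWeight]
  by_cases hp : p.1 ∈ Good ∧ 1 ≤ p.2
  · rw [if_pos hp, if_pos hp]
    have hQpos : (0 : ℝ) < (p.1.residueCard : ℝ) ^ p.2 := by
      have : (0 : ℝ) < p.1.residueCard := by exact_mod_cast zero_lt_one.trans p.1.one_lt_residueCard
      positivity
    have hQnat : (2 : ℝ) ^ Nat.log 2 (p.1.residueCard ^ p.2) ≤ (p.1.residueCard : ℝ) ^ p.2 := by
      have h := Nat.pow_log_le_self 2 (pow_ne_zero p.2 (zero_lt_one.trans p.1.one_lt_residueCard).ne')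
      exact_mod_cast h
    have hsplit : ((p.1.residueCard : ℝ) ^ p.2) ^ (-σ) =
        ((p.1.residueCard : ℝ) ^ p.2)⁻¹ * ((p.1.residueCard : ℝ) ^ p.2) ^ (1 - σ) := by
      rw [← Real.rpow_neg_one, ← Real.rpow_add hQpos]
      congr 1; ring
    have hmono : ((p.1.residueCard : ℝ) ^ p.2) ^ (1 - σ) ≤ ((2 : ℝ) ^ Nat.log 2 (p.1.residueCard ^ p.2)) ^ (1 - σ) :=
      Real.rpow_le_rpow_of_nonpos (by positivity) hQnat (by linarith)
    have hcj : ((2 : ℝ) ^ Nat.log 2 (p.1.residueCard ^ p.2)) ^ (1 - σ) = ((2 : ℝ) ^ (1 - σ)) ^ Nat.log 2 (p.1.residueCard ^ p.2) := by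
      rw [← Real.rpow_natCast, ← Real.rpow_mul (by norm_num), mul_comm, Real.rpow_mul (by norm_num), Real.rpow_natCast]
    rw [hsplit, ← ENNReal.ofReal_pow (by positivity), ← ENNReal.ofReal_mul (by positivity)]
    refine ENNReal.ofReal_le_ofReal ?_
    calc ((p.1.residueCard : ℝ) ^ p.2)⁻¹ * ((p.1.residueCard : ℝ) ^ p.2) ^ (1 - σ) * ‖schur (x p.1) ![p.2, 0]‖ ^ 2
        ≤ ((p.1.residueCard : ℝ) ^ p.2)⁻¹ * ((2 : ℝ) ^ Nat.log 2 (p.1.residueCard ^ p.2)) ^ (1 - σ) *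
            ‖schur (x p.1) ![p.2, 0]‖ ^ 2 := by gcongr
      _ = ((2 : ℝ) ^ (1 - σ)) ^ Nat.log 2 (p.1.residueCard ^ p.2) *
            (((p.1.residueCard : ℝ) ^ p.2)⁻¹ * ‖schur (x p.1) ![p.2, 0]‖ ^ 2) := by rw [hcj]; ring
  · rw [if_neg hp]
    exact bot_le

/-- The block sums of the dyadic weights are `≤ B`. [folklore] -/
theorem tsum_dyadicWeight_block_le {x : HeightOneSpectrum (𝓞 K) → Fin 2 → ℂ} {Good : Set (HeightOneSpectrum (𝓞 K))}
    {B : ℝ≥0∞} (hDY : DyadicBound x Good B) (j : ℕ) :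
    ∑' p : HeightOneSpectrum (𝓞 K) × ℕ, (if Nat.log 2 (p.1.residueCard ^ p.2) = j then dyadicWeight x Good p else 0) ≤ B := by
  classical
  refine ENNReal.summable.tsum_le_of_sum_le fun s => ?_
  have hX : (1 : ℝ) ≤ (2 : ℝ) ^ (j + 1) := one_le_pow₀ (by norm_num)
  have heq : ∑ p ∈ s, (if Nat.log 2 (p.1.residueCard ^ p.2) = j then dyadicWeight x Good p else 0) =
      ∑ p ∈ s.filter (fun p => Nat.log 2 (p.1.residueCard ^ p.2) = j ∧ (p.1 ∈ Good ∧ 1 ≤ p.2)),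
        ENNReal.ofReal (((p.1.residueCard : ℝ) ^ p.2)⁻¹ * ‖schur (x p.1) ![p.2, 0]‖ ^ 2) := by
    rw [Finset.sum_filter]
    refine Finset.sum_congr rfl fun p _ => ?_
    by_cases h1 : Nat.log 2 (p.1.residueCard ^ p.2) = j <;> by_cases h2 : p.1 ∈ Good ∧ 1 ≤ p.2 <;>
      simp [dyadicWeight, h1, h2]
  rw [heq]
  refine hDY ((2 : ℝ) ^ (j + 1)) hX _ fun p hp => ?_
  obtain ⟨-, hpj, hG, hk⟩ := Finset.mem_filter.1 hp
  have hq0 : p.1.residueCard ^ p.2 ≠ 0 := pow_ne_zero p.2 (zero_lt_one.trans p.1.one_lt_residueCard).ne'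
  refine ⟨hG, hk, ?_, ?_⟩
  · rw [pow_succ, mul_div_assoc, div_self two_ne_zero, mul_one]
    have h := Nat.pow_log_le_self 2 hq0
    rw [hpj] at h
    exact_mod_cast h
  · have h := Nat.lt_pow_succ_log_self (b := 2) one_lt_two (p.1.residueCard ^ p.2)
    rw [hpj] at h
    exact_mod_cast h.le

/-- **Dyadic summation**: under the dyadic hypothesis, for `σ > 1`,
`∑_{v ∈ Good, k ≥ 1} (q_v^k)^{-σ} |s_k(x_v)|² ≤ B (1 - 2^{1-σ})⁻¹` (split by the dyadic blocks
`2^j ≤ q_v^k < 2^{j+1}`). [folklore] -/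
theorem tsum_sigmaWeight_le {x : HeightOneSpectrum (𝓞 K) → Fin 2 → ℂ} {Good : Set (HeightOneSpectrum (𝓞 K))}
    {B : ℝ≥0∞} (hDY : DyadicBound x Good B) {σ : ℝ} (hσ : 1 < σ) :
    ∑' p, sigmaWeight x Good σ p ≤ B * (1 - ENNReal.ofReal ((2 : ℝ) ^ (1 - σ)))⁻¹ := by
  classical
  have hpt : ∀ p : HeightOneSpectrum (𝓞 K) × ℕ, sigmaWeight x Good σ p ≤
      ∑' j : ℕ, (if Nat.log 2 (p.1.residueCard ^ p.2) = j then
        ENNReal.ofReal ((2 : ℝ) ^ (1 - σ)) ^ j * dyadicWeight x Good p else 0) := by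
    intro p
    rw [tsum_eq_single (Nat.log 2 (p.1.residueCard ^ p.2)) (fun j hj => if_neg (Ne.symm hj)), if_pos rfl]
    exact sigmaWeight_le x Good hσ p
  calc ∑' p, sigmaWeight x Good σ p
      ≤ ∑' p, ∑' j : ℕ, (if Nat.log 2 (p.1.residueCard ^ p.2) = j then
          ENNReal.ofReal ((2 : ℝ) ^ (1 - σ)) ^ j * dyadicWeight x Good p else 0) := ENNReal.tsum_le_tsum hpt
    _ = ∑' j : ℕ, ∑' p : HeightOneSpectrum (𝓞 K) × ℕ, (if Nat.log 2 (p.1.residueCard ^ p.2) = j then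
          ENNReal.ofReal ((2 : ℝ) ^ (1 - σ)) ^ j * dyadicWeight x Good p else 0) := ENNReal.tsum_comm
    _ = ∑' j : ℕ, ENNReal.ofReal ((2 : ℝ) ^ (1 - σ)) ^ j *
          ∑' p : HeightOneSpectrum (𝓞 K) × ℕ, (if Nat.log 2 (p.1.residueCard ^ p.2) = j then dyadicWeight x Good p else 0) := by
        refine tsum_congr fun j => ?_
        rw [← ENNReal.tsum_mul_left]
        refine tsum_congr fun p => ?_
        split_ifs <;> simp
    _ ≤ ∑' j : ℕ, ENNReal.ofReal ((2 : ℝ) ^ (1 - σ)) ^ j * B :=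
        ENNReal.tsum_le_tsum fun j => mul_le_mul_right (tsum_dyadicWeight_block_le hDY j) _
    _ = B * ∑' j : ℕ, ENNReal.ofReal ((2 : ℝ) ^ (1 - σ)) ^ j := by rw [ENNReal.tsum_mul_right, mul_comm]
    _ = B * (1 - ENNReal.ofReal ((2 : ℝ) ^ (1 - σ)))⁻¹ := by rw [ENNReal.tsum_geometric]

end Dyadic

/-! ### Bounded products -/

section Final

variable {K : Type} [Field K] [NumberField K]

/-- `(1 - u)⁻¹ ≤ exp (2u)` for `0 ≤ u ≤ 1/2`. [folklore] -/
theorem inv_one_sub_le_exp_two_mul {u : ℝ} (hu0 : 0 ≤ u) (hu : u ≤ 1 / 2) : (1 - u)⁻¹ ≤ Real.exp (2 * u) := by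
  have h1 : (1 - u)⁻¹ ≤ 1 + 2 * u := by
    rw [inv_le_iff_one_le_mul₀ (by linarith)]
    nlinarith
  exact h1.trans (by linarith [Real.add_one_le_exp (2 * u)])

/-- `q_v^{-σ} ≤ 1/2` for `σ > 1`. [folklore] -/
theorem residueCard_rpow_neg_le_half (v : HeightOneSpectrum (𝓞 K)) {σ : ℝ} (hσ : 1 < σ) :
    (v.residueCard : ℝ) ^ (-σ) ≤ 1 / 2 := by
  have hq : (2 : ℝ) ≤ v.residueCard := by exact_mod_cast v.one_lt_residueCard
  calc (v.residueCard : ℝ) ^ (-σ) ≤ (2 : ℝ) ^ (-σ) := Real.rpow_le_rpow_of_nonpos (by norm_num) hq (by linarith)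
    _ ≤ (2 : ℝ) ^ (-1 : ℝ) := Real.rpow_le_rpow_of_exponent_le (by norm_num) (by linarith)
    _ = 1 / 2 := by rw [Real.rpow_neg_one]; norm_num

/-- The geometric factor: `∑_b (q_v^{-2σ})^b ≤ exp (2 q_v^{-2σ})`. [folklore] -/
theorem tsum_geometric_residueCard_le (v : HeightOneSpectrum (𝓞 K)) {σ : ℝ} (hσ : 1 < σ) :
    ∑' b : ℕ, ENNReal.ofReal (((v.residueCard : ℝ) ^ (-σ)) ^ 2) ^ b ≤
      ENNReal.ofReal (Real.exp (2 * ((v.residueCard : ℝ) ^ (-σ)) ^ 2)) := by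
  have ht0 : 0 < (v.residueCard : ℝ) ^ (-σ) :=
    Real.rpow_pos_of_pos (by exact_mod_cast zero_lt_one.trans v.one_lt_residueCard) _
  have hu0 : 0 ≤ ((v.residueCard : ℝ) ^ (-σ)) ^ 2 := sq_nonneg _
  have hu : ((v.residueCard : ℝ) ^ (-σ)) ^ 2 ≤ 1 / 2 := by nlinarith [residueCard_rpow_neg_le_half v hσ]
  rw [ENNReal.tsum_geometric, ← ENNReal.ofReal_one, ← ENNReal.ofReal_sub _ hu0,
    ← ENNReal.ofReal_inv_of_pos (by linarith)]
  exact ENNReal.ofReal_le_ofReal (inv_one_sub_le_exp_two_mul hu0 hu)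

/-- The `k ≥ 1` part of `∑_k |s_k(x_v)|² q_v^{-kσ}` is dominated by the `σ`-weights at `v`.
[folklore] -/
theorem tsum_succ_le_tsum_sigmaWeight (x : HeightOneSpectrum (𝓞 K) → Fin 2 → ℂ) {Good : Set (HeightOneSpectrum (𝓞 K))}
    (σ : ℝ) {v : HeightOneSpectrum (𝓞 K)} (hv : v ∈ Good) :
    ∑' k : ℕ, ENNReal.ofReal (‖schur (x v) ![k + 1, 0]‖ ^ 2 * ((v.residueCard : ℝ) ^ (-σ)) ^ (k + 1)) ≤
      ∑' k : ℕ, sigmaWeight x Good σ (v, k) := by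
  classical
  rw [tsum_eq_zero_add' (f := fun k => sigmaWeight x Good σ (v, k)) ENNReal.summable]
  refine le_add_left (ENNReal.tsum_le_tsum fun k => le_of_eq ?_)
  rw [sigmaWeight, if_pos ⟨hv, Nat.le_add_left 1 k⟩, Real.rpow_pow_comm (Nat.cast_nonneg _), mul_comm]

/-- **From dyadic mean-square bounds to bounded Schur self-sum products** (the adapter of the
mean-square method to `JacquetShalika1981_schurSelfSum_prod_bounded` for `GL₂`): if
`|x_{v,0} x_{v,1}| = 1` on `Good` and the single-place dyadic sums are uniformly bounded
(`DyadicBound x Good B`, `B < ∞`), then for every `σ > 1` the products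
`∏_{v ∈ F} schurSelfSum (x_v) (q_v^{-σ})` over finite `F ⊆ Good` are bounded. Proof:
`schurSelfSum (x_v)(t) = (∑_b t^{2b}) (1 + y_v)` (`schurSelfSum_fin_two_eq`) with
`∑_{v ∈ F} y_v ≤ B (1 - 2^{1-σ})⁻¹ = T₁` (`tsum_sigmaWeight_le`), `∏ (1 + y_v) ≤ exp (∑ y_v) ≤ exp T₁`
and `∏_v ∑_b q_v^{-2σ b} ≤ exp (2 ∑_v q_v^{-2σ})` (`summable_residueCard_rpow_neg`). [folklore] -/
theorem schurSelfSum_prod_le_of_dyadicBound {x : HeightOneSpectrum (𝓞 K) → Fin 2 → ℂ}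
    {Good : Set (HeightOneSpectrum (𝓞 K))} (hx1 : ∀ v ∈ Good, ‖x v 0 * x v 1‖ = 1) {B : ℝ≥0∞} (hB : B ≠ ⊤)
    (hDY : DyadicBound x Good B) {σ : ℝ} (hσ : 1 < σ) :
    ∃ C : ℝ≥0∞, C ≠ ⊤ ∧ ∀ F : Finset (HeightOneSpectrum (𝓞 K)), (↑F : Set (HeightOneSpectrum (𝓞 K))) ⊆ Good →
      ∏ v ∈ F, schurSelfSum (x v) ((v.residueCard : ℝ) ^ (-σ)) ≤ C := by
  classical
  -- constants
  have hc1 : ENNReal.ofReal ((2 : ℝ) ^ (1 - σ)) < 1 := by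
    rw [← ENNReal.ofReal_one]
    exact (ENNReal.ofReal_lt_ofReal_iff zero_lt_one).2 (Real.rpow_lt_one_of_one_lt_of_neg (by norm_num) (by linarith))
  have hT₁top : B * (1 - ENNReal.ofReal ((2 : ℝ) ^ (1 - σ)))⁻¹ ≠ ⊤ :=
    ENNReal.mul_ne_top hB (ENNReal.inv_ne_top.2 (tsub_pos_of_lt hc1).ne')
  have hsum2 : Summable fun v : HeightOneSpectrum (𝓞 K) => (v.residueCard : ℝ) ^ (-(2 * σ)) :=
    summable_residueCard_rpow_neg (by linarith)
  refine ⟨ENNReal.ofReal (Real.exp (2 * ∑' v : HeightOneSpectrum (𝓞 K), (v.residueCard : ℝ) ^ (-(2 * σ)))) *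
      ENNReal.ofReal (Real.exp (B * (1 - ENNReal.ofReal ((2 : ℝ) ^ (1 - σ)))⁻¹).toReal),
    ENNReal.mul_ne_top ENNReal.ofReal_ne_top ENNReal.ofReal_ne_top, fun F hF => ?_⟩
  have ht2 : ∀ v : HeightOneSpectrum (𝓞 K), ((v.residueCard : ℝ) ^ (-σ)) ^ 2 = (v.residueCard : ℝ) ^ (-(2 * σ)) := by
    intro v
    rw [← Real.rpow_mul_natCast (Nat.cast_nonneg _)]
    congr 1; push_cast; ring
  -- the `y_v`
  have hyle : ∑ v ∈ F, ∑' k : ℕ, ENNReal.ofReal (‖schur (x v) ![k + 1, 0]‖ ^ 2 * ((v.residueCard : ℝ) ^ (-σ)) ^ (k + 1)) ≤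
      B * (1 - ENNReal.ofReal ((2 : ℝ) ^ (1 - σ)))⁻¹ := by
    calc ∑ v ∈ F, ∑' k : ℕ, ENNReal.ofReal (‖schur (x v) ![k + 1, 0]‖ ^ 2 * ((v.residueCard : ℝ) ^ (-σ)) ^ (k + 1))
        ≤ ∑ v ∈ F, ∑' k : ℕ, sigmaWeight x Good σ (v, k) :=
          Finset.sum_le_sum fun v hv => tsum_succ_le_tsum_sigmaWeight x σ (hF hv)
      _ ≤ ∑' v, ∑' k : ℕ, sigmaWeight x Good σ (v, k) := ENNReal.sum_le_tsum F
      _ = ∑' p, sigmaWeight x Good σ p := ENNReal.tsum_prod.symm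
      _ ≤ B * (1 - ENNReal.ofReal ((2 : ℝ) ^ (1 - σ)))⁻¹ := tsum_sigmaWeight_le hDY hσ
  have hytop : ∀ v ∈ F, ∑' k : ℕ, ENNReal.ofReal (‖schur (x v) ![k + 1, 0]‖ ^ 2 * ((v.residueCard : ℝ) ^ (-σ)) ^ (k + 1)) ≠ ⊤ :=
    fun v hv => ne_top_of_le_ne_top hT₁top ((Finset.single_le_sum (fun w _ => zero_le) hv).trans hyle)
  -- Step 1: factorisation
  have hfac : ∀ v ∈ F, schurSelfSum (x v) ((v.residueCard : ℝ) ^ (-σ)) =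
      (∑' b : ℕ, ENNReal.ofReal (((v.residueCard : ℝ) ^ (-σ)) ^ 2) ^ b) *
        ENNReal.ofReal (1 + (∑' k : ℕ, ENNReal.ofReal (‖schur (x v) ![k + 1, 0]‖ ^ 2 * ((v.residueCard : ℝ) ^ (-σ)) ^ (k + 1))).toReal) := by
    intro v hv
    rw [schurSelfSum_fin_two_eq (hx1 v (hF hv)),
      tsum_eq_zero_add' (f := fun k => ENNReal.ofReal (‖schur (x v) ![k, 0]‖ ^ 2 * ((v.residueCard : ℝ) ^ (-σ)) ^ k))
        ENNReal.summable, schur_vecCons_zero_zero, norm_one,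
      one_pow, pow_zero, mul_one, ENNReal.ofReal_one, ENNReal.ofReal_add zero_le_one ENNReal.toReal_nonneg,
      ENNReal.ofReal_one, ENNReal.ofReal_toReal (hytop v hv)]
  -- Step 2: the geometric factors
  have hprodG : ∏ v ∈ F, (∑' b : ℕ, ENNReal.ofReal (((v.residueCard : ℝ) ^ (-σ)) ^ 2) ^ b) ≤
      ENNReal.ofReal (Real.exp (2 * ∑' v : HeightOneSpectrum (𝓞 K), (v.residueCard : ℝ) ^ (-(2 * σ)))) := by
    calc ∏ v ∈ F, (∑' b : ℕ, ENNReal.ofReal (((v.residueCard : ℝ) ^ (-σ)) ^ 2) ^ b)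
        ≤ ∏ v ∈ F, ENNReal.ofReal (Real.exp (2 * ((v.residueCard : ℝ) ^ (-σ)) ^ 2)) :=
          Finset.prod_le_prod' fun v _ => tsum_geometric_residueCard_le v hσ
      _ = ENNReal.ofReal (∏ v ∈ F, Real.exp (2 * ((v.residueCard : ℝ) ^ (-σ)) ^ 2)) :=
          (ENNReal.ofReal_prod_of_nonneg fun v _ => (Real.exp_pos _).le).symm
      _ = ENNReal.ofReal (Real.exp (2 * ∑ v ∈ F, ((v.residueCard : ℝ) ^ (-σ)) ^ 2)) := by
          rw [← Real.exp_sum, Finset.mul_sum]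
      _ ≤ ENNReal.ofReal (Real.exp (2 * ∑' v : HeightOneSpectrum (𝓞 K), (v.residueCard : ℝ) ^ (-(2 * σ)))) := by
          refine ENNReal.ofReal_le_ofReal (Real.exp_le_exp.2 ?_)
          gcongr
          simp_rw [ht2]
          exact hsum2.sum_le_tsum F fun v _ => Real.rpow_nonneg (Nat.cast_nonneg _) _
  -- Step 3: the `1 + y_v` factors
  have hprodS : ∏ v ∈ F, ENNReal.ofReal (1 + (∑' k : ℕ,
      ENNReal.ofReal (‖schur (x v) ![k + 1, 0]‖ ^ 2 * ((v.residueCard : ℝ) ^ (-σ)) ^ (k + 1))).toReal) ≤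
      ENNReal.ofReal (Real.exp (B * (1 - ENNReal.ofReal ((2 : ℝ) ^ (1 - σ)))⁻¹).toReal) := by
    rw [← ENNReal.ofReal_prod_of_nonneg fun v _ => by positivity]
    refine ENNReal.ofReal_le_ofReal ?_
    calc ∏ v ∈ F, (1 + (∑' k : ℕ, ENNReal.ofReal (‖schur (x v) ![k + 1, 0]‖ ^ 2 * ((v.residueCard : ℝ) ^ (-σ)) ^ (k + 1))).toReal)
        ≤ ∏ v ∈ F, Real.exp ((∑' k : ℕ, ENNReal.ofReal (‖schur (x v) ![k + 1, 0]‖ ^ 2 * ((v.residueCard : ℝ) ^ (-σ)) ^ (k + 1))).toReal) :=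
          Finset.prod_le_prod (fun v _ => by positivity) fun v _ => by
            linarith [Real.add_one_le_exp ((∑' k : ℕ, ENNReal.ofReal (‖schur (x v) ![k + 1, 0]‖ ^ 2 *
              ((v.residueCard : ℝ) ^ (-σ)) ^ (k + 1))).toReal)]
      _ = Real.exp (∑ v ∈ F, (∑' k : ℕ, ENNReal.ofReal (‖schur (x v) ![k + 1, 0]‖ ^ 2 * ((v.residueCard : ℝ) ^ (-σ)) ^ (k + 1))).toReal) :=
          (Real.exp_sum _ _).symm
      _ ≤ Real.exp (B * (1 - ENNReal.ofReal ((2 : ℝ) ^ (1 - σ)))⁻¹).toReal := by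
          refine Real.exp_le_exp.2 ?_
          rw [← ENNReal.toReal_sum hytop]
          exact ENNReal.toReal_mono hT₁top hyle
  -- conclusion
  calc ∏ v ∈ F, schurSelfSum (x v) ((v.residueCard : ℝ) ^ (-σ))
      = ∏ v ∈ F, ((∑' b : ℕ, ENNReal.ofReal (((v.residueCard : ℝ) ^ (-σ)) ^ 2) ^ b) *
          ENNReal.ofReal (1 + (∑' k : ℕ, ENNReal.ofReal (‖schur (x v) ![k + 1, 0]‖ ^ 2 *
            ((v.residueCard : ℝ) ^ (-σ)) ^ (k + 1))).toReal)) := Finset.prod_congr rfl hfac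
    _ = (∏ v ∈ F, ∑' b : ℕ, ENNReal.ofReal (((v.residueCard : ℝ) ^ (-σ)) ^ 2) ^ b) *
          ∏ v ∈ F, ENNReal.ofReal (1 + (∑' k : ℕ, ENNReal.ofReal (‖schur (x v) ![k + 1, 0]‖ ^ 2 *
            ((v.residueCard : ℝ) ^ (-σ)) ^ (k + 1))).toReal) := Finset.prod_mul_distrib
    _ ≤ _ := mul_le_mul' hprodG hprodS

end Final

end Literature.NumberTheory.Automorphic
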